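import Summits.NavierStokesRegularity.OSWSelfSimilar.SheetRSpectrumPointCertificate
import Summits.NavierStokesRegularity.OSWSelfSimilar.SheetRResolventConj
import Summits.NavierStokesRegularity.OSWSelfSimilar.SheetRSpectrumOddAssembly
import Summits.NavierStokesRegularity.OSWSelfSimilar.SheetRLinearisationPerturbation
import Summits.NavierStokesRegularity.OSWSelfSimilar.SheetREvansEnclosure
import Summits.NavierStokesRegularity.OSWSelfSimilar.CertificateViscousSheetRSpectrum
import HarnessLib

/-!
# Sheet-ℝ spectral certificate (Z3-SR-SPEC, S2): THE ASSEMBLY ON THE SHEET — implementation 2's point records + (S1) data ⇒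
# `RectLabelCertificate E*`, the far-field exclusion, and the PASS word «weak point spectrum ∩ {Re σ > −3/100} = {1}, simple»

HONEST FRAMING (cell ns-blowup GROUP B «PROFILE SEARCH»; PROFILE-SPEC v1.3 case Z3-SR-SPEC; 1-D MODEL (viscous gCLM/OSW sheet on `ℝ` at
`(a, c_l, ε) = (1/5, 1/2, 1)`); computer-assisted; not Euler/NS; «violates: none — MODEL»; census hook
`Literature.Analysis.FluidPDE.effectiveViscosity_half`). Nothing here is a statement about Navier–Stokes, and NO enclosure is proved here.
WHAT IT DOES (seat ns-blowup-profile-cert-2 g8; pure composition of tree theorems): for the odd-class Evans functions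
`E  = evansOdd hL K  hK  ℓ f θ` (CENTRE datum `hK : GardingDataKC … K … c m`, `m ≥ 3/20`: the (S1) sentence at `Ω̄`) and
`E* = evansOdd hL K₁ hK₁ ℓ f θ` (PERTURBED datum `hK₁ : GardingDataKC … K₁ … c₁ m₁`, `−m₁ < −3/100`: the (S1*) sentence at `Ω*`, cert-5's
`SheetRLinearisationPerturbation.gardingDataKC_certifiedZero`), with `ℓ = ⟪hv, ·⟫ ∘ subtype`, REAL `hv`, `f` (`Im = 0`) and real `θ` (`Im θ = 0`, `‖θ‖ ≤ 4`):
* §1 `sheet_certificate_of_pointData`: `PointData (resolventKC … K hK) hv f θ E` (implementation 2's 19 point records, kit j270205) +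
  `MixedFarDatum (resolventKC … K hK) hv f 1 B₁ B₂ G₁ G₁′` (its far record) + the ONE scalar inequality
  `|θ|·‖hv‖·‖K₁ − K‖·(4/min(c, 4(m − 3/100)))·‖f‖/(m₁ − 3/100) ≤ 1873/500000` (the (P8) allowance) ⇒
  `RectLabelCertificate E* ∧ (Re σ > −3/100 → ‖σ‖ > 1141/100 → E* σ ≠ 0)` — via `rectLabelCertificate_of_pointData` with
  `hsym` = `SheetRResolventConj.evans_resolventKC_conj'` and `pert` = cert-5's `norm_inner_resolventKC_sub_cross_le` made uniform on `Re ≥ −3/100`;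
* §2 `sheet_weakEigen_set_eq_singleton` / `sheet_weakEigen_one_simple`: + ONE non-trivial weak eigenvector at `σ = 1` ((P6), cert-5's time-shift
  mode) ⇒ selfsim's PASS word `{σ : Re σ > −3/100 ∧ ∃ u ≠ 0, IsWeakEigen … σ u} = {1}` and its algebraic simplicity
  (`SheetRSpectrumOddAssembly.weakEigen_set_eq_singleton` / `weakEigen_one_simple`, hypotheses `hcert`, `hfar` now DISCHARGED from point data);
* §3 `…_of_record`: the (P8) scalar inequality discharged at the literals of record (`CertificateViscousSheetRSpectrum`: `θ = 4`, `c ≥ c₂ = 1/5`,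
  `m ≥ c₁ + γ = 3/20`, `m₁ ≥ m − Δ/4`, `‖K₁ − K‖ ≤ Δ/2`, `Δ = L_lip·rE♯₂`, `‖hv‖²_w ≤ hw2`, `f = hv`): `40·hw2·Δ/(3/25 − Δ/4) ≤ 1873/500000`.
AFTER THIS FILE the Z3-SR-SPEC S2 word for the odd class reads: KERNEL modulo (S1) at the centre (datum `hK`, two arithmetics of record),
(S1*) transfer (cert-5, kernel given `‖u‖_E ≤ rE♯₂` from the existence row), implementation 2's 19 POINT RECORDS + 1 FAR RECORD (interval
arithmetic, BY NAME: `PointData`, `MixedFarDatum`), and (P6). The continuum label certificate, the step rule, the sub-arc logic, the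
conjugate half, the far-field algebra and the hub script `rect_from_json.py` are no longer trusted components.
WHAT THIS IS NOT: not NS; not a proof that the records hold; no number of record moves, no label changes.
-/

noncomputable section

namespace Summit.NavierStokesRegularity.OSWSelfSimilar
namespace SheetRSpectrumPointAssembly

open _root_.MeasureTheory _root_.Set _root_.Filter _root_.Real SheetRWeakProfilePV SheetRWeakToStrong SheetREnergyClass SheetRWeightedMeasure
  SheetRLinearisedTests SheetREnergySpace SheetRTestSpace SheetRLinearisedFormBounds SheetRSolutionOperator SheetRLinearisedCutoffEnergy
  SheetRResolventPair SheetRComplexPivot SheetRResolventComplex SheetRResolventIdentity SheetRPerturbedUniqueness SheetRPerturbedPair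
  SheetRPerturbedResolventC SheetRPerturbedResolventIdentityC SheetROddClass SheetRResolventOddClass SheetRGeneratorOddWeak SheetREvansOdd
  SheetREvansEnclosure SheetRSpectrumWindingLists SheetRSpectrumStepRule SheetRSpectrumPointCertificate SheetRResolventConj
  SheetRLinearisationPerturbation SheetRSpectrumOddAssembly Literature.Analysis.OperatorTheory Literature.Analysis.Complex Complex
open scoped Topology ENNReal ComplexConjugate InnerProductSpace

variable {L D₀ D₁ V₀ c m c₁ m₁ : ℝ} {d V : ℝ → ℝ}

/-! ### §1 Point records ⇒ the certificate for `E*` -/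

/-- **THE SHEET CERTIFICATE FROM POINT DATA.** See the module docstring (§1). [folklore] -/
theorem sheet_certificate_of_pointData (hL : 0 < L) (K K₁ : Esp L hL →L[ℝ] W L)
    (hK : GardingDataKC L hL d V K D₀ D₁ V₀ c m) (hK₁ : GardingDataKC L hL d V K₁ D₀ D₁ V₀ c₁ m₁)
    (hm : (3 : ℝ) / 20 ≤ m) (hm₁ : -m₁ < ra)
    {hv : Wc L} {f : Wcodd L} (hh : imW L hv = 0) (hf : imW L (f : Wc L) = 0) {θ : ℂ} (hθ : ‖θ‖ ≤ 4) (hθr : θ.im = 0)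
    (hP : ‖θ‖ * (‖hv‖ * (‖K₁ - K‖ * (4 / min c (4 * (m + ra))) * ‖(f : Wc L)‖ / (m₁ + ra))) ≤ (1873 : ℝ) / 500000)
    (hPD : PointData (resolventKC hL K hK) hv (f : Wc L) θ
      (evansOdd hL K hK ((innerSL ℂ hv).comp (Wcodd L).subtypeL) f θ))
    (hFD : MixedFarDatum (resolventKC hL K hK) hv (f : Wc L) 1 ((3593635617 : ℝ) / 5000000000)
      ((331182857 : ℝ) / 250000000) ((802337581 : ℝ) / 500000000) ((1710547133 : ℝ) / 1000000000)) :
    RectLabelCertificate (evansOdd hL K₁ hK₁ ((innerSL ℂ hv).comp (Wcodd L).subtypeL) f θ) ∧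
      ∀ σ : ℂ, ra < σ.re → (1141 : ℝ) / 100 < ‖σ‖ →
        evansOdd hL K₁ hK₁ ((innerSL ℂ hv).comp (Wcodd L).subtypeL) f θ σ ≠ 0 := by
  set ℓ : Wcodd L →L[ℂ] ℂ := (innerSL ℂ hv).comp (Wcodd L).subtypeL with hℓ
  have hθeq : θ = ((θ.re : ℝ) : ℂ) := Complex.ext (by simp) (by simp [hθr])
  have hE : ∀ w, evansOdd hL K hK ℓ f θ w = 1 - θ * ⟪hv, resolventKC hL K hK w (f : Wc L)⟫_ℂ := fun w => by
    rw [hℓ, evansOdd_comp_subtypeL, innerSL_apply_apply]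
  have hE' : ∀ w, evansOdd hL K hK ℓ f θ w = 1 - ((θ.re : ℝ) : ℂ) * ⟪hv, resolventKC hL K hK w (f : Wc L)⟫_ℂ := fun w => by
    rw [hE, ← hθeq]
  have hE₁ : ∀ w, evansOdd hL K₁ hK₁ ℓ f θ w = 1 - θ * ⟪hv, resolventKC hL K₁ hK₁ w (f : Wc L)⟫_ℂ := fun w => by
    rw [hℓ, evansOdd_comp_subtypeL, innerSL_apply_apply]
  have hJ := isPseudoResolventKC hL K hK
  have hra : ra = -(3 : ℝ) / 100 := rfl
  have hmra : -m < ra := by rw [hra]; linarith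
  have hU : ∀ w : ℂ, ra ≤ w.re → w ∈ {σ : ℂ | -m < σ.re} := fun w hw => lt_of_lt_of_le hmra hw
  have hb : ∀ w : ℂ, ra ≤ w.re → ∀ G : Wc L, ‖resolventKC hL K hK w G‖ ≤ ‖G‖ / (m + w.re) :=
    fun w hw G => norm_resolventKC_le_inv hL K hK (hU w hw) G
  have hsym := evans_resolventKC_conj' hK hh hf θ.re hE'
  -- the (P8) allowance, uniform on `Re ≥ ra`
  have hκ₀ : 0 < min c (4 * (m + ra)) := kappaC_pos hK hmra
  have hm₁ra : 0 < m₁ + ra := by linarith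
  have hpert : ∀ w : ℂ, ra ≤ w.re → ‖evansOdd hL K₁ hK₁ ℓ f θ w - evansOdd hL K hK ℓ f θ w‖ ≤
      ‖θ‖ * (‖hv‖ * (‖K₁ - K‖ * (4 / min c (4 * (m + ra))) * ‖(f : Wc L)‖ / (m₁ + ra))) := by
    intro w hw
    have hσ : -m < w.re := hU w hw
    have hσ₁ : -m₁ < w.re := lt_of_lt_of_le hm₁ hw
    have hx := norm_inner_resolventKC_sub_cross_le hK hK₁ hσ hσ₁ hv (f : Wc L)
    rw [hE₁, hE]
    have e : (1 - θ * ⟪hv, resolventKC hL K₁ hK₁ w (f : Wc L)⟫_ℂ) - (1 - θ * ⟪hv, resolventKC hL K hK w (f : Wc L)⟫_ℂ) =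
        θ * (⟪hv, resolventKC hL K hK w (f : Wc L)⟫_ℂ - ⟪hv, resolventKC hL K₁ hK₁ w (f : Wc L)⟫_ℂ) := by ring
    rw [e, norm_mul]
    refine mul_le_mul_of_nonneg_left (hx.trans ?_) (norm_nonneg θ)
    have hmin : min c (4 * (m + ra)) ≤ min c (4 * (m + w.re)) := min_le_min le_rfl (by linarith)
    have hden : m₁ + ra ≤ m₁ + w.re := by linarith
    have h4 : 4 / min c (4 * (m + w.re)) ≤ 4 / min c (4 * (m + ra)) := div_le_div_of_nonneg_left (by norm_num) hκ₀ hmin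
    have hnum : ‖K₁ - K‖ * (4 / min c (4 * (m + w.re))) * ‖(f : Wc L)‖ ≤ ‖K₁ - K‖ * (4 / min c (4 * (m + ra))) * ‖(f : Wc L)‖ := by
      gcongr
    have hnn : 0 ≤ ‖K₁ - K‖ * (4 / min c (4 * (m + ra))) * ‖(f : Wc L)‖ := by positivity
    refine mul_le_mul_of_nonneg_left ?_ (norm_nonneg hv)
    calc ‖K₁ - K‖ * (4 / min c (4 * (m + w.re))) * ‖(f : Wc L)‖ / (m₁ + w.re)
        ≤ ‖K₁ - K‖ * (4 / min c (4 * (m + ra))) * ‖(f : Wc L)‖ / (m₁ + w.re) :=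
          div_le_div_of_nonneg_right hnum (by linarith)
      _ ≤ ‖K₁ - K‖ * (4 / min c (4 * (m + ra))) * ‖(f : Wc L)‖ / (m₁ + ra) :=
          div_le_div_of_nonneg_left hnn hm₁ra hden
  exact rectLabelCertificate_of_pointData hJ hU hm hb hθ hE hsym hpert hP hPD hFD

/-! ### §2 The PASS word with `hcert`, `hfar` discharged -/

/-- **THE PASS WORD FROM POINT DATA**: under §1's hypotheses and ONE non-trivial weak eigenvector at `σ = 1` ((P6)), the set of `σ` with
`Re σ > −3/100` carrying a non-trivial weak eigenvector of `A* − θℓ(·)f` (the odd-class linearisation keyed by `K₁`) is `{1}`. [folklore] -/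
theorem sheet_weakEigen_set_eq_singleton (hL : 0 < L) (K K₁ : Esp L hL →L[ℝ] W L)
    (hK : GardingDataKC L hL d V K D₀ D₁ V₀ c m) (hK₁ : GardingDataKC L hL d V K₁ D₀ D₁ V₀ c₁ m₁)
    (hm : (3 : ℝ) / 20 ≤ m) (hm₁ : -m₁ < ra)
    {hv : Wc L} {f : Wcodd L} (hh : imW L hv = 0) (hf : imW L (f : Wc L) = 0) {θ : ℂ} (hθ : ‖θ‖ ≤ 4) (hθr : θ.im = 0)
    (hP : ‖θ‖ * (‖hv‖ * (‖K₁ - K‖ * (4 / min c (4 * (m + ra))) * ‖(f : Wc L)‖ / (m₁ + ra))) ≤ (1873 : ℝ) / 500000)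
    (hPD : PointData (resolventKC hL K hK) hv (f : Wc L) θ
      (evansOdd hL K hK ((innerSL ℂ hv).comp (Wcodd L).subtypeL) f θ))
    (hFD : MixedFarDatum (resolventKC hL K hK) hv (f : Wc L) 1 ((3593635617 : ℝ) / 5000000000)
      ((331182857 : ℝ) / 250000000) ((802337581 : ℝ) / 500000000) ((1710547133 : ℝ) / 1000000000))
    {v : Wcodd L} (hv0 : v ≠ 0) (hv1 : IsWeakEigen hL K₁ d V ((innerSL ℂ hv).comp (Wcodd L).subtypeL) f θ 1 v) :
    {σ : ℂ | ra < σ.re ∧ ∃ u : Wcodd L, u ≠ 0 ∧ IsWeakEigen hL K₁ d V ((innerSL ℂ hv).comp (Wcodd L).subtypeL) f θ σ u} = {1} := by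
  obtain ⟨hcert, hfar⟩ := sheet_certificate_of_pointData hL K K₁ hK hK₁ hm hm₁ hh hf hθ hθr hP hPD hFD
  exact weakEigen_set_eq_singleton hL K₁ hK₁ hm₁ _ f θ hcert hfar hv0 hv1

/-- **SIMPLICITY FROM POINT DATA**: under the same hypotheses, the weak eigenvalue `σ = 1` is geometrically and algebraically simple. [folklore] -/
theorem sheet_weakEigen_one_simple (hL : 0 < L) (K K₁ : Esp L hL →L[ℝ] W L)
    (hK : GardingDataKC L hL d V K D₀ D₁ V₀ c m) (hK₁ : GardingDataKC L hL d V K₁ D₀ D₁ V₀ c₁ m₁)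
    (hm : (3 : ℝ) / 20 ≤ m) (hm₁ : -m₁ < ra)
    {hv : Wc L} {f : Wcodd L} (hh : imW L hv = 0) (hf : imW L (f : Wc L) = 0) {θ : ℂ} (hθ : ‖θ‖ ≤ 4) (hθr : θ.im = 0)
    (hP : ‖θ‖ * (‖hv‖ * (‖K₁ - K‖ * (4 / min c (4 * (m + ra))) * ‖(f : Wc L)‖ / (m₁ + ra))) ≤ (1873 : ℝ) / 500000)
    (hPD : PointData (resolventKC hL K hK) hv (f : Wc L) θ
      (evansOdd hL K hK ((innerSL ℂ hv).comp (Wcodd L).subtypeL) f θ))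
    (hFD : MixedFarDatum (resolventKC hL K hK) hv (f : Wc L) 1 ((3593635617 : ℝ) / 5000000000)
      ((331182857 : ℝ) / 250000000) ((802337581 : ℝ) / 500000000) ((1710547133 : ℝ) / 1000000000))
    {v : Wcodd L} (hv0 : v ≠ 0) (hv1 : IsWeakEigen hL K₁ d V ((innerSL ℂ hv).comp (Wcodd L).subtypeL) f θ 1 v) :
    resolventOdd hL K₁ hK₁ 1 f ≠ 0 ∧
      (∀ u : Wcodd L, IsWeakEigen hL K₁ d V ((innerSL ℂ hv).comp (Wcodd L).subtypeL) f θ 1 u ↔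
        ∃ t : ℂ, u = t • resolventOdd hL K₁ hK₁ 1 f) ∧
      ∀ δ₀ : Wcodd L, δ₀ ≠ 0 → IsWeakEigen hL K₁ d V ((innerSL ℂ hv).comp (Wcodd L).subtypeL) f θ 1 δ₀ →
        ¬ ∃ δ₁ : Wcodd L, IsWeakJordan hL K₁ d V ((innerSL ℂ hv).comp (Wcodd L).subtypeL) f θ 1 δ₀ δ₁ := by
  obtain ⟨hcert, -⟩ := sheet_certificate_of_pointData hL K K₁ hK hK₁ hm hm₁ hh hf hθ hθr hP hPD hFD
  exact weakEigen_one_simple hL K₁ hK₁ hm₁ _ f θ hcert hv0 hv1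

/-! ### §3 The (P8) scalar inequality at the literals of record -/

section Record

open CertificateViscousSheetRSpectrum (c1 c2 gamma Delta hw2)
open CertificateViscousSheetR (Llip rEsharp2)

/-- **The (P8) allowance at the literals of record is below `pert = 0.003746`**: `4·(4·hw2·(Δ/2)·20)/(3/25 − Δ/4) ≤ 1873/500000`
(`Δ = L_lip·rE♯₂ = 1.3026e-5`, `hw2 = 0.71872713`; value ≈ 0.00312). [folklore] -/
theorem pert_of_record_le :
    (4 : ℝ) * (((hw2 : ℚ) : ℝ) * (((Delta : ℚ) : ℝ) / 2 * 20)) / ((3 : ℝ) / 25 - ((Delta : ℚ) : ℝ) / 4) ≤ (1873 : ℝ) / 500000 := by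
  norm_num [hw2, Delta, Llip, rEsharp2]

/-- **THE SHEET CERTIFICATE AT THE DATA OF RECORD** (`θ = 4`, `f = h` real with `‖h‖²_w ≤ hw2`, centre datum `(c, m)` with `c ≥ c₂ = 1/5`,
`m ≥ c₁ + γ = 3/20`, perturbed datum `(c₁, m₁)` with `m₁ ≥ m − Δ/4` and `‖K₁ − K‖ ≤ Δ/2` — cert-5's `gardingDataKC_certifiedZero` /
`norm_secondVariation_le_sheet` supply exactly these): implementation 2's point records and far record give `RectLabelCertificate E*` and the
far-field exclusion, the (P8) allowance being discharged by `pert_of_record_le`. [folklore] -/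
theorem sheet_certificate_of_record (hL : 0 < L) (K K₁ : Esp L hL →L[ℝ] W L)
    (hK : GardingDataKC L hL d V K D₀ D₁ V₀ c m) (hK₁ : GardingDataKC L hL d V K₁ D₀ D₁ V₀ c₁ m₁)
    (hc : ((c2 : ℚ) : ℝ) ≤ c) (hm : ((c1 : ℚ) : ℝ) + ((gamma : ℚ) : ℝ) ≤ m) (hm₁ : m - ((Delta : ℚ) : ℝ) / 4 ≤ m₁)
    (hKK : ‖K₁ - K‖ ≤ ((Delta : ℚ) : ℝ) / 2)
    {hv : Wc L} {f : Wcodd L} (hh : imW L hv = 0) (hfh : (f : Wc L) = hv) (hhw : ‖hv‖ ^ 2 ≤ ((hw2 : ℚ) : ℝ))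
    (hPD : PointData (resolventKC hL K hK) hv (f : Wc L) 4
      (evansOdd hL K hK ((innerSL ℂ hv).comp (Wcodd L).subtypeL) f 4))
    (hFD : MixedFarDatum (resolventKC hL K hK) hv (f : Wc L) 1 ((3593635617 : ℝ) / 5000000000)
      ((331182857 : ℝ) / 250000000) ((802337581 : ℝ) / 500000000) ((1710547133 : ℝ) / 1000000000)) :
    RectLabelCertificate (evansOdd hL K₁ hK₁ ((innerSL ℂ hv).comp (Wcodd L).subtypeL) f 4) ∧
      ∀ σ : ℂ, ra < σ.re → (1141 : ℝ) / 100 < ‖σ‖ →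
        evansOdd hL K₁ hK₁ ((innerSL ℂ hv).comp (Wcodd L).subtypeL) f 4 σ ≠ 0 := by
  have hra : ra = -(3 : ℝ) / 100 := rfl
  have hc2 : ((c2 : ℚ) : ℝ) = 1 / 5 := by norm_num [c2]
  have hcg : ((c1 : ℚ) : ℝ) + ((gamma : ℚ) : ℝ) = 3 / 20 := by norm_num [c1, gamma]
  have hD0 : (0 : ℝ) ≤ ((Delta : ℚ) : ℝ) := by norm_num [Delta, Llip, rEsharp2]
  have hD1 : ((Delta : ℚ) : ℝ) ≤ 1 / 50 := by norm_num [Delta, Llip, rEsharp2]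
  have hm' : (3 : ℝ) / 20 ≤ m := by linarith
  have hm₁' : -m₁ < ra := by rw [hra]; linarith
  have hf : imW L (f : Wc L) = 0 := by rw [hfh, hh]
  have hθ : ‖(4 : ℂ)‖ ≤ 4 := by simp
  have hθr : (4 : ℂ).im = 0 := by simp
  -- the (P8) scalar inequality
  have hκ : (1 : ℝ) / 5 ≤ min c (4 * (m + ra)) := le_min (by linarith) (by rw [hra]; linarith)
  have hκ0 : 0 < min c (4 * (m + ra)) := lt_of_lt_of_le (by norm_num) hκ
  have h4κ : 4 / min c (4 * (m + ra)) ≤ 20 := by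
    rw [div_le_iff₀ hκ0]; linarith
  have hden : (3 : ℝ) / 25 - ((Delta : ℚ) : ℝ) / 4 ≤ m₁ + ra := by rw [hra]; linarith
  have hden0 : 0 < (3 : ℝ) / 25 - ((Delta : ℚ) : ℝ) / 4 := by linarith
  have hnum : ‖hv‖ * (‖K₁ - K‖ * (4 / min c (4 * (m + ra))) * ‖(f : Wc L)‖) ≤
      ((hw2 : ℚ) : ℝ) * (((Delta : ℚ) : ℝ) / 2 * 20) := by
    rw [hfh]
    calc ‖hv‖ * (‖K₁ - K‖ * (4 / min c (4 * (m + ra))) * ‖hv‖) = ‖hv‖ ^ 2 * (‖K₁ - K‖ * (4 / min c (4 * (m + ra)))) := by ring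
      _ ≤ ((hw2 : ℚ) : ℝ) * (((Delta : ℚ) : ℝ) / 2 * 20) := by
          refine mul_le_mul hhw (mul_le_mul hKK h4κ (by positivity) (by positivity)) (by positivity) ?_
          exact le_trans (by positivity) hhw
  have hDpos : 0 < m₁ + ra := lt_of_lt_of_le hden0 hden
  have hLHS0 : 0 ≤ ‖hv‖ * (‖K₁ - K‖ * (4 / min c (4 * (m + ra))) * ‖(f : Wc L)‖) := by positivity
  have hN0 : 0 ≤ 4 * (((hw2 : ℚ) : ℝ) * (((Delta : ℚ) : ℝ) / 2 * 20)) := by nlinarith [hnum, hLHS0]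
  have hP : ‖(4 : ℂ)‖ * (‖hv‖ * (‖K₁ - K‖ * (4 / min c (4 * (m + ra))) * ‖(f : Wc L)‖ / (m₁ + ra))) ≤ (1873 : ℝ) / 500000 := by
    have h4 : ‖(4 : ℂ)‖ = 4 := by simp
    have e : ‖(4 : ℂ)‖ * (‖hv‖ * (‖K₁ - K‖ * (4 / min c (4 * (m + ra))) * ‖(f : Wc L)‖ / (m₁ + ra))) =
        4 * (‖hv‖ * (‖K₁ - K‖ * (4 / min c (4 * (m + ra))) * ‖(f : Wc L)‖)) / (m₁ + ra) := by
      rw [h4]; ring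
    rw [e]
    calc 4 * (‖hv‖ * (‖K₁ - K‖ * (4 / min c (4 * (m + ra))) * ‖(f : Wc L)‖)) / (m₁ + ra)
        ≤ 4 * (((hw2 : ℚ) : ℝ) * (((Delta : ℚ) : ℝ) / 2 * 20)) / (m₁ + ra) :=
          div_le_div_of_nonneg_right (by linarith [hnum]) hDpos.le
      _ ≤ 4 * (((hw2 : ℚ) : ℝ) * (((Delta : ℚ) : ℝ) / 2 * 20)) / ((3 : ℝ) / 25 - ((Delta : ℚ) : ℝ) / 4) :=
          div_le_div_of_nonneg_left hN0 hden0 hden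
      _ ≤ (1873 : ℝ) / 500000 := pert_of_record_le
  exact sheet_certificate_of_pointData hL K K₁ hK hK₁ hm' hm₁' hh hf hθ hθr hP hPD hFD

end Record

end SheetRSpectrumPointAssembly
end Summit.NavierStokesRegularity.OSWSelfSimilar

end
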